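import Summits.Parity.GeneralizedHardyLittlewood.Theorems.PrimeLevelFamEdgeMomentsBeyondDiagonalDiagCornerAbelRay
import HarnessLib

/-!
# Route `PrimeLevelFamEdge`, crux K_A `MomentsBeyondDiagonal` (stmt-Parity-20007), line «petersson_layers» v4, stub `stub_diag`:
# **ray variation across `y = 1` (the constant `V` of the two-variable Abel estimate)**

A weight `r` that is `√`-Lipschitz on `(0,1]` (`|r(y₁)−r(y₂)| ≤ C_s(y₂−y₁)/√y₁`), `1/y`-Lipschitz on `[1,M]`
(`|r(y₁)−r(y₂)| ≤ K(y₂−y₁)/y₁`) and bounded by `G` on `(0,M]` — the shape of the continued Bose remainders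
(`…DiagBoseMixedRemainderSqrt`, `…DiagBoseMixedTailRem`) — has, along ANY arithmetic ray `e ↦ r(ce)` with `c(w+1) ≤ M`,
variation at most `2C_s + 2G + K(1+log w)`: the ray is split at `⌊1/c⌋` into a `(0,1]` piece
(`…DiagCornerAbelBV.sum_abs_sub_le_of_lipschitz_sqrt`), at most one crossing step (`≤ 2G`), and a `[1,M]` piece
(`…DiagCornerAbelRay.sum_abs_sub_le_of_lipschitz_inv`).

* `sum_abs_sub_ray_le` — **`Σ_{u<e≤w}|r(c(e+1)) − r(ce)| ≤ 2C_s + 2G + K(1 + log w)`**.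

Def-free; theorems only. Helper `--supports stmt-Parity-20007`; closes nothing; K_A, K_B and the Parity summit are NOT
proved; nothing about Landau–Siegel zeros.

## References
* E. Kowalski, P. Michel, J. VanderKam, J. reine angew. Math. 526 (2000), Prop. 5.1 p. 18.
  [cite: KowalskiMichelVanderKam2000, Prop. 5.1 — derivation (summation by parts in the corner of the diagonal)]
-/

noncomputable section

open Finset Real

namespace Summit.Parity.GeneralizedHardyLittlewood.Theorems.MomentsBeyondDiagonal.DiagCorner

/-- **Ray variation across `y = 1`.** Let `c > 0`, `u ≤ w`, `c(w+1) ≤ M`; suppose `|r(y₁)−r(y₂)| ≤ C_s(y₂−y₁)/√y₁` for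
`0<y₁≤y₂≤1`, `|r(y₁)−r(y₂)| ≤ K(y₂−y₁)/y₁` for `1≤y₁≤y₂≤M` (`K ≥ 0`), and `|r(y)| ≤ G` for `0 < y ≤ M`. Then
`Σ_{u<e≤w}|r(c(e+1)) − r(ce)| ≤ 2C_s + 2G + K(1+log w)`. [folklore] -/
theorem sum_abs_sub_ray_le {r : ℝ → ℝ} {Cs K G M c : ℝ} (hc : 0 < c) (hK : 0 ≤ K)
    (hS : ∀ y₁ y₂ : ℝ, 0 < y₁ → y₁ ≤ y₂ → y₂ ≤ 1 → |r y₁ - r y₂| ≤ Cs * (y₂ - y₁) / Real.sqrt y₁)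
    (hT : ∀ y₁ y₂ : ℝ, 1 ≤ y₁ → y₁ ≤ y₂ → y₂ ≤ M → |r y₁ - r y₂| ≤ K * (y₂ - y₁) / y₁)
    (hG : ∀ y : ℝ, 0 < y → y ≤ M → |r y| ≤ G)
    {u w : ℕ} (huw : u ≤ w) (hw : c * ((w : ℝ) + 1) ≤ M) :
    ∑ e ∈ Ioc u w, |r (c * ((e : ℝ) + 1)) - r (c * e)| ≤ 2 * Cs + 2 * G + K * (1 + Real.log w) := by
  -- nonnegativity of the constants
  have hG0 : 0 ≤ G := (abs_nonneg _).trans (hG (c * ((w : ℝ) + 1)) (by positivity) hw)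
  have hlogw : 0 ≤ 1 + Real.log w := by
    rcases Nat.eq_zero_or_pos w with h | h
    · simp [h]
    · have : (1 : ℝ) ≤ w := by exact_mod_cast h
      linarith [Real.log_nonneg this]
  set F : ℕ → ℝ := fun e ↦ |r (c * ((e : ℝ) + 1)) - r (c * e)| with hF
  have hF0 : ∀ e, 0 ≤ F e := fun e ↦ abs_nonneg _
  -- every single step is at most `2G`
  have hstep : ∀ e ∈ Ioc u w, F e ≤ 2 * G := by
    intro e he
    have he' := Finset.mem_Ioc.1 he
    have he0 : (0 : ℝ) < e := by exact_mod_cast (show 0 < e by omega)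
    have hew : (e : ℝ) + 1 ≤ (w : ℝ) + 1 := by exact_mod_cast (show e + 1 ≤ w + 1 by omega)
    have h1 := hG (c * ((e : ℝ) + 1)) (by positivity) ((by nlinarith : c * ((e : ℝ) + 1) ≤ c * ((w : ℝ) + 1)).trans hw)
    have h2 := hG (c * e) (by positivity) ((by nlinarith : c * (e : ℝ) ≤ c * ((w : ℝ) + 1)).trans hw)
    calc F e ≤ |r (c * ((e : ℝ) + 1))| + |r (c * e)| := abs_sub _ _
      _ ≤ G + G := add_le_add h1 h2
      _ = 2 * G := by ring
  -- the split point `m₁ = ⌊1/c⌋₊`: `c m₁ ≤ 1 < c (m₁ + 1)`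
  set m₁ : ℕ := ⌊1 / c⌋₊ with hm₁
  have hm₁le : c * (m₁ : ℝ) ≤ 1 := by
    have h := Nat.floor_le (show (0 : ℝ) ≤ 1 / c by positivity)
    rw [← hm₁] at h
    calc c * (m₁ : ℝ) ≤ c * (1 / c) := by gcongr
      _ = 1 := by field_simp
  have hm₁lt : 1 < c * ((m₁ : ℝ) + 1) := by
    have h := Nat.lt_floor_add_one (1 / c)
    rw [← hm₁] at h
    calc (1 : ℝ) = c * (1 / c) := by field_simp
      _ < c * ((m₁ : ℝ) + 1) := by gcongr
  -- clamp the split points into `[u, w]`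
  set s₁ : ℕ := max u (min w (m₁ - 1)) with hs₁
  set s₂ : ℕ := max u (min w m₁) with hs₂
  have hus₁ : u ≤ s₁ := le_max_left _ _
  have hs₁₂ : s₁ ≤ s₂ := by
    rw [hs₁, hs₂]; exact max_le_max le_rfl (min_le_min le_rfl (Nat.sub_le _ _))
  have hs₂w : s₂ ≤ w := max_le huw (min_le_left _ _)
  have hsplit : ∑ e ∈ Ioc u w, F e = (∑ e ∈ Ioc u s₁, F e) + (∑ e ∈ Ioc s₁ s₂, F e) + ∑ e ∈ Ioc s₂ w, F e := by
    rw [Finset.sum_Ioc_consecutive F hus₁ hs₁₂, Finset.sum_Ioc_consecutive F (hus₁.trans hs₁₂) hs₂w]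
  -- piece 1: `e ≤ s₁ ≤ m₁ − 1`, so `c(e+1) ≤ c m₁ ≤ 1` (empty if `s₁ = u`)
  have hpiece1 : ∑ e ∈ Ioc u s₁, F e ≤ 2 * Cs := by
    rcases eq_or_lt_of_le hus₁ with h | h
    · rw [← h, Finset.Ioc_self, Finset.sum_empty]
      -- `Cs ≥ 0`: from `hS` at `y₁ = c m₁ /2`? simpler: if the piece is empty we need `0 ≤ 2Cs`; obtain it from `hS` when
      -- `m₁ ≥ 1`, and otherwise from the instance `y₁ = y₂ = 1/2`.
      have h1 := hS (1 / 4) (1 / 2) (by norm_num) (by norm_num) (by norm_num)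
      have : 0 ≤ Cs * (1 / 2 - 1 / 4) / Real.sqrt (1 / 4) := (abs_nonneg _).trans h1
      have hq : (0 : ℝ) < (1 / 2 - 1 / 4) / Real.sqrt (1 / 4) := by positivity
      have : 0 ≤ Cs := by
        rw [mul_div_assoc] at this
        exact nonneg_of_mul_nonneg_left this hq
      linarith
    · -- here `u < s₁`, so `s₁ = min w (m₁ - 1) ≤ m₁ - 1` and `m₁ ≥ 1`
      have hs₁' : s₁ = min w (m₁ - 1) := by
        rw [hs₁]; exact max_eq_right (le_of_lt (by rw [hs₁] at h; exact lt_max_iff.1 h |>.resolve_left (lt_irrefl _)))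
      have hs₁m : s₁ + 1 ≤ m₁ := by
        have : s₁ ≤ m₁ - 1 := hs₁' ▸ min_le_right _ _
        omega
      have hcw : c * ((s₁ : ℝ) + 1) ≤ 1 := by
        have : (s₁ : ℝ) + 1 ≤ m₁ := by exact_mod_cast hs₁m
        calc c * ((s₁ : ℝ) + 1) ≤ c * m₁ := by gcongr
          _ ≤ 1 := hm₁le
      have hray := sum_abs_sub_le_of_lipschitz_sqrt (r := r) (C := Cs) hc hS h.le hcw
      have hsq1 : Real.sqrt (c * ((s₁ : ℝ) + 1)) ≤ 1 := Real.sqrt_le_one.2 hcw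
      have hCs0 : 0 ≤ Cs := by
        have h1 := hS (1 / 4) (1 / 2) (by norm_num) (by norm_num) (by norm_num)
        have h2 : 0 ≤ Cs * (1 / 2 - 1 / 4) / Real.sqrt (1 / 4) := (abs_nonneg _).trans h1
        have hq : (0 : ℝ) < (1 / 2 - 1 / 4) / Real.sqrt (1 / 4) := by positivity
        rw [mul_div_assoc] at h2
        exact nonneg_of_mul_nonneg_left h2 hq
      calc ∑ e ∈ Ioc u s₁, F e ≤ 2 * Cs * Real.sqrt (c * ((s₁ : ℝ) + 1)) := hray
        _ ≤ 2 * Cs * 1 := by gcongr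
        _ = 2 * Cs := mul_one _
  -- piece 2: at most one index
  have hpiece2 : ∑ e ∈ Ioc s₁ s₂, F e ≤ 2 * G := by
    have hcard : (Ioc s₁ s₂).card ≤ 1 := by
      rw [Nat.card_Ioc]
      rw [hs₁, hs₂]
      omega
    calc ∑ e ∈ Ioc s₁ s₂, F e ≤ ∑ e ∈ Ioc s₁ s₂, 2 * G :=
          Finset.sum_le_sum fun e he ↦ hstep e (Finset.Ioc_subset_Ioc hus₁ hs₂w he)
      _ = (Ioc s₁ s₂).card * (2 * G) := by rw [Finset.sum_const, nsmul_eq_mul]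
      _ ≤ 1 * (2 * G) := by gcongr; exact_mod_cast hcard
      _ = 2 * G := one_mul _
  -- piece 3: `e ≥ s₂ + 1 ≥ m₁ + 1`, so `c e ≥ c(m₁+1) > 1` (empty if `s₂ = w`)
  have hpiece3 : ∑ e ∈ Ioc s₂ w, F e ≤ K * (1 + Real.log w) := by
    rcases eq_or_lt_of_le hs₂w with h | h
    · rw [h, Finset.Ioc_self, Finset.sum_empty]; positivity
    · have hs₂' : m₁ ≤ s₂ := by
        -- `s₂ < w` forces `min w m₁ = m₁`, hence `s₂ = max u m₁ ≥ m₁`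
        have : min w m₁ = m₁ := by
          rw [min_eq_right_iff]
          by_contra hlt
          rw [not_le] at hlt
          have : s₂ = max u w := by rw [hs₂, min_eq_left hlt.le]
          rw [this] at h
          exact absurd h (not_lt.2 (le_max_right _ _))
        rw [hs₂, this]; exact le_max_right _ _
      have hu' : 1 ≤ c * ((s₂ : ℝ) + 1) := by
        have : (m₁ : ℝ) + 1 ≤ (s₂ : ℝ) + 1 := by exact_mod_cast Nat.succ_le_succ hs₂'
        exact hm₁lt.le.trans (by nlinarith)
      exact sum_abs_sub_le_of_lipschitz_inv (r := r) hK hc hT hu' hw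
  rw [hsplit]
  linarith [hpiece1, hpiece2, hpiece3]

end Summit.Parity.GeneralizedHardyLittlewood.Theorems.MomentsBeyondDiagonal.DiagCorner

end
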